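import Mathlib
import HarnessLib
import Summits.ValiantsHypothesis.ValiantsHypothesis.Theses.ValuativeGCT
import Literature.Computability.AlgebraicComplexity.OrbitClosureWeights
import Literature.Computability.AlgebraicComplexity.StandardFamilies
import Summits.ValiantsHypothesis.ValiantsHypothesis.Theorems.ValuativeGCTValuativeFlipGrowthGap
import Summits.ValiantsHypothesis.ValiantsHypothesis.Theorems.ValuativeGCTValuativeFlipStabInvLeExplicit
import Summits.ValiantsHypothesis.ValiantsHypothesis.Theorems.ValuativeGCTValuativeFlipFourRowSliceBound
import Summits.ValiantsHypothesis.ValiantsHypothesis.Theorems.ValuativeGCTValuativeFlipFourRowTransfer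

/-!
# Line `four-row-count` — checked skeleton for crux `ValuativeGCT.HeadFlip`
(stmt-ValiantsHypothesis-15535; lead prover-line-stmt-ValiantsHypothesis-15535-0, 2026-08-16;
parent skeleton `Cruxes/ValuativeFlip/Lines/four_row_count.lean` by the crux-strategist of
stmt-12624, line card `Cruxes/ValuativeFlip/Lines/four-row-count.md`).

THE LINE.  On shapes `λ` with at most four rows both sides of the crux inequality only see the four
kept rows of `A ∈ End W`: the det side `Hom ⊓ SAND ⊓ ROWS₄` has a slice of dimension `2m² + m + 1`
(`stub_fourRowSliceBound`, LANDED), the per side is the coordinate ring of the four-row orbit image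
`closure{ℓ(y)^{m-n} per_n(M(y))} ⊂ Sym^m ℂ⁴`, whose Hilbert function is bounded below by
`C(δ+N, N)` once the four-row tangent span at some `g · pp` has dimension `≥ N + 1`
(`stub_fourRowHilbertLowerBound`); a dimension gap on the four-row modules yields a `≤ 4`-row
weight that flips (`stub_fourRowBridge`).  The load-bearing input is the four-row tangent rank
`≥ 2m² + m + 2` on the whole head `n ≤ m ≤ (a/b)·n`; by the landed transfer
`frt_finrank_fourRowSpan_ge` it follows from an `m`-FREE certificate: a four-variable pencil `M(y)`
with `dim span{y_t · Per_ij(M(y))} ≥ 2⌊an/b⌋² + ⌊an/b⌋ + 2`.  `HeadFlip` quantifies the slope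
existentially, so ANY `(2+ε)n²` certificate suffices (the lead's reshaping of the parent stub
`stub_fourRowPencilRank`, whose registered form hard-codes the slope `6/5`).

THE CERTIFICATE (this lead's line of attack; exact mod-p numerics in the seat folder
`work/numerics/`): the rank-one perturbation of a diagonal pencil, `M(y) = diag(d_k(y)) + u(y)·1ᵀ`
(`d_k, u_k` linear forms), has CLOSED-FORM permanental minors
`Per_ij = u_j · Σ_{S ⊆ [n]∖{i,j}} (|S|+1)! u^S d^{[n]∖{i,j}∖S}` (`i ≠ j`),
`Per_ii = Σ_{S ⊆ [n]∖{i}} |S|! u^S d^{[n]∖{i}∖S}` (`stub_subpermDiagRankOne`) — the factorials are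
exactly the characteristic-0 content that the parity cap (`Cruxes/HeadFlip/IdeatorOneSketch.lean`,
`parityCap`) demands of any certificate — and its four-row tangent family has rank `3n² + 1` for
generic forms (`3n² - 3n + 2` for `d_k = y₃ + k y₀`, `u_k = k² y₁ + k³ y₂`; exact mod-p ranks,
`n ≤ 16`), comfortably above `(2+ε)n²` (`stub_rankBound`, the heart).

THE CUT (sorries only in `stub_*`):
* `stub_fourRowHilbertLowerBound` — verbatim from the parent skeleton (per-side Hilbert function);
* `stub_fourRowBridge`            — verbatim from the parent skeleton (`GL₄`-equivariant bridge);
* `stub_subpermDiagRankOne`       — closed form of the sub-permanents of `diag(d) + u·1ᵀ` (M, true);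
* `stub_rankBound`                — a `(2+ε)n²` rank certificate for such a pencil (L, the heart).
GLUE (sorry-free over the stubs): `pencilCertificate_of`, `fourRowPencilRank_of_pencilCertificate'`
(slope-general form of the landed reduction), `headCensus_of` (parent's, over the LANDED slice
bound), `headFlipBody_of'` (slope-general), `HeadFlip_of : ValuativeGCT.HeadFlip` BY NAME.

Disproof / negatives honoured (parent Disproof.lean F4/F5b/F2/F3, landed `NoValuativeFlip*`): the
centre is `U = ⊥, r = 0` (an sk-flip), the flipping shape has `mult_pp > dim ≥ 1` (not one-row),
and the head `m ≤ (a/b) n` is far below `1 + n(n+1)^4` (`NoValuativeFlipBoundedLength`).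
-/

set_option linter.dupNamespace false
set_option maxHeartbeats 800000

namespace Summit.ValiantsHypothesis.ValiantsHypothesis.Cruxes.HeadFlip.FourRowCount

open MvPolynomial
open scoped BigOperators Matrix
open Literature.NumberTheory.DiophantineGeometry
open Literature.Computability.AlgebraicComplexity
open Summit.ValiantsHypothesis.ValiantsHypothesis.Theorems.ValuativeFlip

noncomputable section

/-! ## The stubs (sorries live ONLY here) -/

/-- **stub_fourRowHilbertLowerBound** (per side, size M–L; verbatim from the parent skeleton; four-row
analogue of the landed B3 `stub_hilbertLowerBound`, base point moved from `A = 1` to `A = g`; part 1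
of a proof is landed as `Theorems/ValuativeGCTValuativeFlipFourRowHilbertTools.lean`).  If the
four-row tangent span of `g · pp` has dimension `≥ N + 1`, the degree-`δ` piece of the FOUR-ROW orbit
image has dimension `≥ C(δ+N, N)`.
[Mulmuley–Sohoni 2001 §4; Theorems/ValuativeGCTValuativeFlipHilbertLowerBound.lean (B3); folklore] -/
theorem stub_fourRowHilbertLowerBound :
    ∀ (n m : ℕ) [NeZero m], n ≤ m → ∀ (g : GL (MatIdx m) ℂ) (N δ : ℕ),
      N + 1 ≤ Module.finrank ℂ ↥(Submodule.span ℂ (Set.range fun ab : {a : MatIdx m // m * m ≤ (((matIdxEquiv m).symm a : Fin (m * m)) : ℕ) + 4} × MatIdx m => (MvPolynomial.X ab.1.1 : MvPolynomial (MatIdx m) ℂ) * MvPolynomial.aeval (fun i : MatIdx m => if m * m ≤ (((matIdxEquiv m).symm i : Fin (m * m)) : ℕ) + 4 then (MvPolynomial.X i : MvPolynomial (MatIdx m) ℂ) else 0) (MvPolynomial.pderiv ab.2 (linSubst (MatIdx m) ℂ ((g : GL (MatIdx m) ℂ) : Matrix (MatIdx m) (MatIdx m) ℂ) (paddedPerFormLex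 ℂ n m))))) →
      Nat.choose (δ + N) N ≤ Module.finrank ℂ ↥(((MvPolynomial.homogeneousSubmodule (DegIdx (MatIdx m) m) ℂ δ ⊓ Subalgebra.toSubmodule (MvPolynomial.supported ℂ {d : DegIdx (MatIdx m) m | ∀ i : MatIdx m, ¬ (m * m ≤ (((matIdxEquiv m).symm i : Fin (m * m)) : ℕ) + 4) → d.1 i = 0})).map (genericOrbitMap (paddedPerFormLex ℂ n m) m).toLinearMap)) := by
  sorry

/-- **stub_fourRowBridge** (representation theory, size L; verbatim from the parent skeleton; four-row
analogue of the landed B6 `stub_bottomBridge`, now `GL₄`-equivariant; landed pieces: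
`fourRow_borel_of_blockBorel`, `fourRow_hwsp_inf_map_genericOrbitMap_le_orbitMultiplicity`,
`fourRow_detMult_le_fourRow`, `fourRowHwspLeRows`).  A dimension gap between the two four-row modules
in degree `δ` yields a partition `λ ⊢ mδ` with `ℓ(λ) ≤ 4` and
`dim(Hom_{mδ} ⊓ SAND ⊓ HWSP(λ*)) < mult_{λ*} ℂ[Δ_m(X₀₀^{m-n} per_n)]`.
[BLMW 2011 §5.2; Goodman–Wallach §3.2, §4.1; arXiv:1204.4693 Prop. 1.12; B6, B4] -/
theorem stub_fourRowBridge :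
    ∀ (n m : ℕ) [NeZero m] (δ : ℕ), n ≤ m → 2 ≤ m →
      Module.finrank ℂ ↥(MvPolynomial.homogeneousSubmodule (MatIdx m × MatIdx m) ℂ (m * δ) ⊓
        (⨅ (P : Matrix (Fin m) (Fin m) ℂ) (Q : Matrix (Fin m) (Fin m) ℂ) (_ : P.det = 1) (_ : Q.det = 1), LinearMap.ker ((MvPolynomial.aeval fun p : MatIdx m × MatIdx m => ∑ l : MatIdx m, (P (ofLex p.2).1 (ofLex l).1 * Q (ofLex l).2 (ofLex p.2).2) • (MvPolynomial.X (p.1, l) : MvPolynomial (MatIdx m × MatIdx m) ℂ)).toLinearMap - (LinearMap.id : MvPolynomial (MatIdx m × MatIdx m) ℂ →ₗ[ℂ] MvPolynomial (MatIdx m × MatIdx m) ℂ))) ⊓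
        Subalgebra.toSubmodule (MvPolynomial.supported ℂ {p : MatIdx m × MatIdx m | m * m ≤ (((matIdxEquiv m).symm p.1 : Fin (m * m)) : ℕ) + 4})) <
      Module.finrank ℂ ↥(((MvPolynomial.homogeneousSubmodule (DegIdx (MatIdx m) m) ℂ δ ⊓ Subalgebra.toSubmodule (MvPolynomial.supported ℂ {d : DegIdx (MatIdx m) m | ∀ i : MatIdx m, ¬ (m * m ≤ (((matIdxEquiv m).symm i : Fin (m * m)) : ℕ) + 4) → d.1 i = 0})).map (genericOrbitMap (paddedPerFormLex ℂ n m) m).toLinearMap)) →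
      ∃ lam : Nat.Partition (m * δ), lam.parts.card ≤ 4 ∧
        Module.finrank ℂ ↥(MvPolynomial.homogeneousSubmodule (MatIdx m × MatIdx m) ℂ (m * δ) ⊓
          (⨅ (P : Matrix (Fin m) (Fin m) ℂ) (Q : Matrix (Fin m) (Fin m) ℂ) (_ : P.det = 1) (_ : Q.det = 1), LinearMap.ker ((MvPolynomial.aeval fun p : MatIdx m × MatIdx m => ∑ l : MatIdx m, (P (ofLex p.2).1 (ofLex l).1 * Q (ofLex l).2 (ofLex p.2).2) • (MvPolynomial.X (p.1, l) : MvPolynomial (MatIdx m × MatIdx m) ℂ)).toLinearMap - (LinearMap.id : MvPolynomial (MatIdx m × MatIdx m) ℂ →ₗ[ℂ] MvPolynomial (MatIdx m × MatIdx m) ℂ))) ⊓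
          (⨅ (g : Matrix.GeneralLinearGroup (MatIdx m) ℂ) (_ : IsUpperTriangular g), LinearMap.ker ((MvPolynomial.aeval fun p : MatIdx m × MatIdx m => ∑ l : MatIdx m, ((g⁻¹ : Matrix.GeneralLinearGroup (MatIdx m) ℂ) : Matrix (MatIdx m) (MatIdx m) ℂ) p.1 l • (MvPolynomial.X (l, p.2) : MvPolynomial (MatIdx m × MatIdx m) ℂ)).toLinearMap - weightChar ((Weight.dualOfPartition (m * m) lam).toMatIdx : Weight (MatIdx m)) g • (LinearMap.id : MvPolynomial (MatIdx m × MatIdx m) ℂ →ₗ[ℂ] MvPolynomial (MatIdx m × MatIdx m) ℂ)))) <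
        orbitMultiplicity ℂ (paddedPerFormLex ℂ n m) m ((Weight.dualOfPartition (m * m) lam).toMatIdx : Weight (MatIdx m)) := by
  sorry

/-- **stub_subpermDiagRankOne** (closed form, size M).  The sub-permanents of the rank-one
perturbation of a diagonal matrix, `N = diag(d) + u·1ᵀ` (`N_kl = d_k δ_kl + u_k` over a commutative
`K`-algebra `A`): `Per_ii = Σ_{S ⊆ [n]∖{i}} |S|!·u^S·d^{[n]∖{i}∖S}` and, for `i ≠ j`,
`Per_ij = u_j · Σ_{S ⊆ [n]∖{i,j}} (|S|+1)!·u^S·d^{[n]∖{i,j}∖S}` (a bijection `[n]∖i → [n]∖j` using the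
rank-one entry exactly in the rows `R` must have `j ∈ R`, is the identity off `R ∪ {i}`, and there are
`|R|!` of them; put `R = S ∪ {j}`).  Stated for `∂_{(i,j)} per_n` (the sub-permanent deleting row `i`
and column `j`, `VonZurGathen.pderiv_perPoly`) evaluated at the pencil.
[folklore: permanent of a diagonal plus a rank-one matrix; Minc, *Permanents* (1978) §2.1] -/
theorem stub_subpermDiagRankOne :
    ∀ {K A : Type} [CommRing K] [CommRing A] [Algebra K A] {n : ℕ} (d u : Fin n → A) (i j : Fin n),
      MvPolynomial.aeval (fun kl : Fin n × Fin n => (if kl.1 = kl.2 then d kl.1 else 0) + u kl.1)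
          (MvPolynomial.pderiv (i, j) (perPoly (Fin n) K)) =
        if i = j then
          ∑ S ∈ (Finset.univ.erase i).powerset,
            (S.card.factorial : A) * (∏ k ∈ S, u k) * ∏ k ∈ (Finset.univ.erase i) \ S, d k
        else
          u j * ∑ S ∈ ((Finset.univ.erase i).erase j).powerset,
            ((S.card + 1).factorial : A) * (∏ k ∈ S, u k) * ∏ k ∈ ((Finset.univ.erase i).erase j) \ S, d k := by
  sorry

/-- **stub_rankBound** (the COMBINATORIAL HEART, size L).  For some slope `a/b > 1` and all
large `n` there are linear forms `d_k(y) = Σ_t d k t · y_t`, `u_k(y) = Σ_t u k t · y_t` in four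
variables such that (i) four cells of the pencil `diag(d) + u·1ᵀ` carry linearly independent forms
and (ii) the `4n²` products `y_t · Per_ij(diag(d(y)) + u(y)·1ᵀ)` — written in the closed form of
`stub_subpermDiagRankOne` — span at least `2⌊an/b⌋² + ⌊an/b⌋ + 2` dimensions.  Numerically the
span is `3n² + 1` for generic forms and `3n² - 3n + 2` for `d_k = y₃ + k y₀`, `u_k = k² y₁ + k³ y₂`
(exact mod-p ranks, `n ≤ 16`, seat folder `work/numerics/`), so any `(2+ε)n²` argument closes it
(slope `11/10` needs `2.42n² + 1.1n + 2`).  [new; this line] -/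
theorem stub_rankBound :
    ∃ a b : ℕ, 0 < b ∧ b < a ∧ ∃ n₀ : ℕ, ∀ n ≥ n₀, ∃ (d u : Fin n → Fin 4 → ℂ) (c : Fin 4 → Fin n × Fin n),
      IsUnit (Matrix.of fun t t' : Fin 4 =>
        (if (c t').1 = (c t').2 then d (c t').1 t else 0) + u (c t').1 t) ∧
      2 * (a * n / b) ^ 2 + a * n / b + 2 ≤
        Module.finrank ℂ ↥(Submodule.span ℂ (Set.range fun tij : Fin 4 × (Fin n × Fin n) =>
          (X tij.1 : MvPolynomial (Fin 4) ℂ) *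
            (if tij.2.1 = tij.2.2 then
              ∑ S ∈ (Finset.univ.erase tij.2.1).powerset,
                (S.card.factorial : MvPolynomial (Fin 4) ℂ) *
                  (∏ k ∈ S, ∑ t : Fin 4, u k t • (X t : MvPolynomial (Fin 4) ℂ)) *
                  ∏ k ∈ (Finset.univ.erase tij.2.1) \ S, ∑ t : Fin 4, d k t • (X t : MvPolynomial (Fin 4) ℂ)
            else
              (∑ t : Fin 4, u tij.2.2 t • (X t : MvPolynomial (Fin 4) ℂ)) *
                ∑ S ∈ ((Finset.univ.erase tij.2.1).erase tij.2.2).powerset,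
                  ((S.card + 1).factorial : MvPolynomial (Fin 4) ℂ) *
                    (∏ k ∈ S, ∑ t : Fin 4, u k t • (X t : MvPolynomial (Fin 4) ℂ)) *
                    ∏ k ∈ ((Finset.univ.erase tij.2.1).erase tij.2.2) \ S, ∑ t : Fin 4, d k t • (X t : MvPolynomial (Fin 4) ℂ)))) := by
  sorry

/-! ## Glue (sorry-free): certificate ⇒ four-row tangent rank on the head ⇒ census ⇒ HeadFlip -/

/-- The `m`-free certificate in the shape of the landed reduction, from the two pencil stubs: the
pencil is `M_{kl} = d_k δ_{kl} + u_k`, and the closed form rewrites `∂_{kl} per_n` on it into the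
family whose span the rank stub bounds. [this line] -/
theorem pencilCertificate_of
    (hC1 : ∀ {K A : Type} [CommRing K] [CommRing A] [Algebra K A] {n : ℕ} (d u : Fin n → A) (i j : Fin n),
      MvPolynomial.aeval (fun kl : Fin n × Fin n => (if kl.1 = kl.2 then d kl.1 else 0) + u kl.1)
          (MvPolynomial.pderiv (i, j) (perPoly (Fin n) K)) =
        if i = j then
          ∑ S ∈ (Finset.univ.erase i).powerset,
            (S.card.factorial : A) * (∏ k ∈ S, u k) * ∏ k ∈ (Finset.univ.erase i) \ S, d k
        else
          u j * ∑ S ∈ ((Finset.univ.erase i).erase j).powerset,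
            ((S.card + 1).factorial : A) * (∏ k ∈ S, u k) * ∏ k ∈ ((Finset.univ.erase i).erase j) \ S, d k)
    (hC2 : ∃ a b : ℕ, 0 < b ∧ b < a ∧ ∃ n₀ : ℕ, ∀ n ≥ n₀, ∃ (d u : Fin n → Fin 4 → ℂ) (c : Fin 4 → Fin n × Fin n),
      IsUnit (Matrix.of fun t t' : Fin 4 =>
        (if (c t').1 = (c t').2 then d (c t').1 t else 0) + u (c t').1 t) ∧
      2 * (a * n / b) ^ 2 + a * n / b + 2 ≤
        Module.finrank ℂ ↥(Submodule.span ℂ (Set.range fun tij : Fin 4 × (Fin n × Fin n) =>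
          (X tij.1 : MvPolynomial (Fin 4) ℂ) *
            (if tij.2.1 = tij.2.2 then
              ∑ S ∈ (Finset.univ.erase tij.2.1).powerset,
                (S.card.factorial : MvPolynomial (Fin 4) ℂ) *
                  (∏ k ∈ S, ∑ t : Fin 4, u k t • (X t : MvPolynomial (Fin 4) ℂ)) *
                  ∏ k ∈ (Finset.univ.erase tij.2.1) \ S, ∑ t : Fin 4, d k t • (X t : MvPolynomial (Fin 4) ℂ)
            else
              (∑ t : Fin 4, u tij.2.2 t • (X t : MvPolynomial (Fin 4) ℂ)) *
                ∑ S ∈ ((Finset.univ.erase tij.2.1).erase tij.2.2).powerset,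
                  ((S.card + 1).factorial : MvPolynomial (Fin 4) ℂ) *
                    (∏ k ∈ S, ∑ t : Fin 4, u k t • (X t : MvPolynomial (Fin 4) ℂ)) *
                    ∏ k ∈ ((Finset.univ.erase tij.2.1).erase tij.2.2) \ S, ∑ t : Fin 4, d k t • (X t : MvPolynomial (Fin 4) ℂ))))) :
    ∃ a b : ℕ, 0 < b ∧ b < a ∧ ∃ n₀ : ℕ, ∀ n ≥ n₀, ∃ (M : Fin n × Fin n → Fin 4 → ℂ) (c : Fin 4 → Fin n × Fin n),
      IsUnit (Matrix.of fun t t' : Fin 4 => M (c t') t) ∧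
      2 * (a * n / b) ^ 2 + a * n / b + 2 ≤
        Module.finrank ℂ ↥(Submodule.span ℂ (Set.range fun tc : Fin 4 × (Fin n × Fin n) =>
          (X tc.1 : MvPolynomial (Fin 4) ℂ) *
            aeval (fun ij : Fin n × Fin n => ∑ t : Fin 4, M ij t • (X t : MvPolynomial (Fin 4) ℂ))
              (pderiv tc.2 (perPoly (Fin n) ℂ)))) := by
  obtain ⟨a, b, hb, hba, n₀, hn₀⟩ := hC2
  refine ⟨a, b, hb, hba, n₀, fun n hn => ?_⟩
  obtain ⟨d, u, c, hunit, hrank⟩ := hn₀ n hn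
  refine ⟨fun ij t => (if ij.1 = ij.2 then d ij.1 t else 0) + u ij.1 t, c, ?_, ?_⟩
  · simpa using hunit
  · set D : Fin n → MvPolynomial (Fin 4) ℂ := fun k => ∑ t : Fin 4, d k t • (X t : MvPolynomial (Fin 4) ℂ)
      with hD
    set U : Fin n → MvPolynomial (Fin 4) ℂ := fun k => ∑ t : Fin 4, u k t • (X t : MvPolynomial (Fin 4) ℂ)
      with hU
    have hentry : (fun ij : Fin n × Fin n => ∑ t : Fin 4,
        ((if ij.1 = ij.2 then d ij.1 t else 0) + u ij.1 t) • (X t : MvPolynomial (Fin 4) ℂ)) =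
        fun kl : Fin n × Fin n => (if kl.1 = kl.2 then D kl.1 else 0) + U kl.1 := by
      funext kl
      by_cases h : kl.1 = kl.2
      · simp only [h, if_true, hD, hU, add_smul, Finset.sum_add_distrib]
      · simp only [h, if_false, zero_add, hU]
    have hclosed : ∀ ij : Fin n × Fin n,
        aeval (fun ij : Fin n × Fin n => ∑ t : Fin 4,
          ((if ij.1 = ij.2 then d ij.1 t else 0) + u ij.1 t) • (X t : MvPolynomial (Fin 4) ℂ))
            (pderiv ij (perPoly (Fin n) ℂ)) =
        (if ij.1 = ij.2 then
              ∑ S ∈ (Finset.univ.erase ij.1).powerset,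
                (S.card.factorial : MvPolynomial (Fin 4) ℂ) * (∏ k ∈ S, U k) *
                  ∏ k ∈ (Finset.univ.erase ij.1) \ S, D k
            else
              U ij.2 * ∑ S ∈ ((Finset.univ.erase ij.1).erase ij.2).powerset,
                  ((S.card + 1).factorial : MvPolynomial (Fin 4) ℂ) * (∏ k ∈ S, U k) *
                    ∏ k ∈ ((Finset.univ.erase ij.1).erase ij.2) \ S, D k) := by
      rintro ⟨i, j⟩
      rw [hentry]
      exact hC1 (K := ℂ) (A := MvPolynomial (Fin 4) ℂ) D U i j
    have hfam : (fun tc : Fin 4 × (Fin n × Fin n) =>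
          (X tc.1 : MvPolynomial (Fin 4) ℂ) *
            aeval (fun ij : Fin n × Fin n => ∑ t : Fin 4,
              ((if ij.1 = ij.2 then d ij.1 t else 0) + u ij.1 t) • (X t : MvPolynomial (Fin 4) ℂ))
              (pderiv tc.2 (perPoly (Fin n) ℂ))) =
        (fun tij : Fin 4 × (Fin n × Fin n) =>
          (X tij.1 : MvPolynomial (Fin 4) ℂ) *
            (if tij.2.1 = tij.2.2 then
              ∑ S ∈ (Finset.univ.erase tij.2.1).powerset,
                (S.card.factorial : MvPolynomial (Fin 4) ℂ) *
                  (∏ k ∈ S, ∑ t : Fin 4, u k t • (X t : MvPolynomial (Fin 4) ℂ)) *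
                  ∏ k ∈ (Finset.univ.erase tij.2.1) \ S, ∑ t : Fin 4, d k t • (X t : MvPolynomial (Fin 4) ℂ)
            else
              (∑ t : Fin 4, u tij.2.2 t • (X t : MvPolynomial (Fin 4) ℂ)) *
                ∑ S ∈ ((Finset.univ.erase tij.2.1).erase tij.2.2).powerset,
                  ((S.card + 1).factorial : MvPolynomial (Fin 4) ℂ) *
                    (∏ k ∈ S, ∑ t : Fin 4, u k t • (X t : MvPolynomial (Fin 4) ℂ)) *
                    ∏ k ∈ ((Finset.univ.erase tij.2.1).erase tij.2.2) \ S, ∑ t : Fin 4, d k t • (X t : MvPolynomial (Fin 4) ℂ))) := by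
      funext tc
      rw [hclosed tc.2]
    rw [hfam]
    exact hrank

/-- **Slope-general form of the landed reduction** `fourRowPencilRank_of_pencilCertificate`
(Theorems/ValuativeGCTValuativeFlipFourRowTransfer.lean, whose statement hard-codes `6/5`): by the
transfer `frt_finrank_fourRowSpan_ge`, a certificate `≥ 2⌊an/b⌋² + ⌊an/b⌋ + 2` at every large `n`
gives the four-row tangent rank `≥ 2m² + m + 2` at every `n ≤ m`, `b·m ≤ a·n`. [parent line; folklore] -/
theorem fourRowPencilRank_of_pencilCertificate' (a b : ℕ) (hb : 0 < b)
    (H : ∃ n₀ : ℕ, ∀ n ≥ n₀, ∃ (M : Fin n × Fin n → Fin 4 → ℂ) (c : Fin 4 → Fin n × Fin n),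
      IsUnit (Matrix.of fun t t' : Fin 4 => M (c t') t) ∧
      2 * (a * n / b) ^ 2 + a * n / b + 2 ≤
        Module.finrank ℂ ↥(Submodule.span ℂ (Set.range fun tc : Fin 4 × (Fin n × Fin n) =>
          (X tc.1 : MvPolynomial (Fin 4) ℂ) *
            aeval (fun ij : Fin n × Fin n => ∑ t : Fin 4, M ij t • (X t : MvPolynomial (Fin 4) ℂ))
              (pderiv tc.2 (perPoly (Fin n) ℂ))))) :
    ∃ n₀ : ℕ, ∀ n ≥ n₀, ∀ (m : ℕ) [NeZero m], n ≤ m → b * m ≤ a * n →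
      ∃ g : GL (MatIdx m) ℂ, 2 * m ^ 2 + m + 2 ≤ Module.finrank ℂ ↥(Submodule.span ℂ (Set.range fun ab : {a : MatIdx m // m * m ≤ (((matIdxEquiv m).symm a : Fin (m * m)) : ℕ) + 4} × MatIdx m => (MvPolynomial.X ab.1.1 : MvPolynomial (MatIdx m) ℂ) * MvPolynomial.aeval (fun i : MatIdx m => if m * m ≤ (((matIdxEquiv m).symm i : Fin (m * m)) : ℕ) + 4 then (MvPolynomial.X i : MvPolynomial (MatIdx m) ℂ) else 0) (MvPolynomial.pderiv ab.2 (linSubst (MatIdx m) ℂ ((g : GL (MatIdx m) ℂ) : Matrix (MatIdx m) (MatIdx m) ℂ) (paddedPerFormLex ℂ n m))))) := by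
  obtain ⟨n₀, hn₀⟩ := H
  refine ⟨max n₀ 2, fun n hn m _ hnm hbm => ?_⟩
  obtain ⟨M, c, hc, hrank⟩ := hn₀ n (le_of_max_le_left hn)
  have hm : 2 ≤ m := (le_of_max_le_right hn).trans hnm
  obtain ⟨g, hg⟩ := frt_finrank_fourRowSpan_ge n m hnm hm M c hc
  refine ⟨g, le_trans ?_ (hrank.trans hg)⟩
  have h1 : m ≤ a * n / b := (Nat.le_div_iff_mul_le hb).2 (by simpa [Nat.mul_comm] using hbm)
  have h2 : m ^ 2 ≤ (a * n / b) ^ 2 := Nat.pow_le_pow_left h1 2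
  linarith

/-- The four-row census at one window position of the head (verbatim from the parent skeleton):
from the slice bound, the Hilbert lower bound and the bridge, a four-row tangent rank `≥ 2m²+m+2` at
some `g` yields a `≤ 4`-row `λ ⊢ mδ` with
`dim(Hom_{mδ} ⊓ SAND ⊓ HWSP(λ*)) < mult_{λ*} ℂ[Δ_m(X₀₀^{m-n} per_n)]`.  Sorry-free (growth gap =
landed B5). [parent line four-row-count] -/
theorem headCensus_of (hS1 : ∀ (m : ℕ), 2 ≤ m → ∀ D : ℕ,
      Module.finrank ℂ ↥(MvPolynomial.homogeneousSubmodule (MatIdx m × MatIdx m) ℂ (D) ⊓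
        (⨅ (P : Matrix (Fin m) (Fin m) ℂ) (Q : Matrix (Fin m) (Fin m) ℂ) (_ : P.det = 1) (_ : Q.det = 1), LinearMap.ker ((MvPolynomial.aeval fun p : MatIdx m × MatIdx m => ∑ l : MatIdx m, (P (ofLex p.2).1 (ofLex l).1 * Q (ofLex l).2 (ofLex p.2).2) • (MvPolynomial.X (p.1, l) : MvPolynomial (MatIdx m × MatIdx m) ℂ)).toLinearMap - (LinearMap.id : MvPolynomial (MatIdx m × MatIdx m) ℂ →ₗ[ℂ] MvPolynomial (MatIdx m × MatIdx m) ℂ))) ⊓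
        Subalgebra.toSubmodule (MvPolynomial.supported ℂ {p : MatIdx m × MatIdx m | m * m ≤ (((matIdxEquiv m).symm p.1 : Fin (m * m)) : ℕ) + 4})) ≤ (D + 1) ^ (2 * m ^ 2 + m))
    (hS3 : ∀ (n m : ℕ) [NeZero m], n ≤ m → ∀ (g : GL (MatIdx m) ℂ) (N δ : ℕ),
      N + 1 ≤ Module.finrank ℂ ↥(Submodule.span ℂ (Set.range fun ab : {a : MatIdx m // m * m ≤ (((matIdxEquiv m).symm a : Fin (m * m)) : ℕ) + 4} × MatIdx m => (MvPolynomial.X ab.1.1 : MvPolynomial (MatIdx m) ℂ) * MvPolynomial.aeval (fun i : MatIdx m => if m * m ≤ (((matIdxEquiv m).symm i : Fin (m * m)) : ℕ) + 4 then (MvPolynomial.X i : MvPolynomial (MatIdx m) ℂ) else 0) (MvPolynomial.pderiv ab.2 (linSubst (MatIdx m) ℂ ((g : GL (MatIdx m) ℂ) : Matrix (MatIdx m) (MatIdx m) ℂ) (paddedPerFormLex ℂ n m))))) →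
      Nat.choose (δ + N) N ≤ Module.finrank ℂ ↥(((MvPolynomial.homogeneousSubmodule (DegIdx (MatIdx m) m) ℂ δ ⊓ Subalgebra.toSubmodule (MvPolynomial.supported ℂ {d : DegIdx (MatIdx m) m | ∀ i : MatIdx m, ¬ (m * m ≤ (((matIdxEquiv m).symm i : Fin (m * m)) : ℕ) + 4) → d.1 i = 0})).map (genericOrbitMap (paddedPerFormLex ℂ n m) m).toLinearMap)))
    (hS4 : ∀ (n m : ℕ) [NeZero m] (δ : ℕ), n ≤ m → 2 ≤ m →
      Module.finrank ℂ ↥(MvPolynomial.homogeneousSubmodule (MatIdx m × MatIdx m) ℂ (m * δ) ⊓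
        (⨅ (P : Matrix (Fin m) (Fin m) ℂ) (Q : Matrix (Fin m) (Fin m) ℂ) (_ : P.det = 1) (_ : Q.det = 1), LinearMap.ker ((MvPolynomial.aeval fun p : MatIdx m × MatIdx m => ∑ l : MatIdx m, (P (ofLex p.2).1 (ofLex l).1 * Q (ofLex l).2 (ofLex p.2).2) • (MvPolynomial.X (p.1, l) : MvPolynomial (MatIdx m × MatIdx m) ℂ)).toLinearMap - (LinearMap.id : MvPolynomial (MatIdx m × MatIdx m) ℂ →ₗ[ℂ] MvPolynomial (MatIdx m × MatIdx m) ℂ))) ⊓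
        Subalgebra.toSubmodule (MvPolynomial.supported ℂ {p : MatIdx m × MatIdx m | m * m ≤ (((matIdxEquiv m).symm p.1 : Fin (m * m)) : ℕ) + 4})) <
      Module.finrank ℂ ↥(((MvPolynomial.homogeneousSubmodule (DegIdx (MatIdx m) m) ℂ δ ⊓ Subalgebra.toSubmodule (MvPolynomial.supported ℂ {d : DegIdx (MatIdx m) m | ∀ i : MatIdx m, ¬ (m * m ≤ (((matIdxEquiv m).symm i : Fin (m * m)) : ℕ) + 4) → d.1 i = 0})).map (genericOrbitMap (paddedPerFormLex ℂ n m) m).toLinearMap)) →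
      ∃ lam : Nat.Partition (m * δ), lam.parts.card ≤ 4 ∧
        Module.finrank ℂ ↥(MvPolynomial.homogeneousSubmodule (MatIdx m × MatIdx m) ℂ (m * δ) ⊓
          (⨅ (P : Matrix (Fin m) (Fin m) ℂ) (Q : Matrix (Fin m) (Fin m) ℂ) (_ : P.det = 1) (_ : Q.det = 1), LinearMap.ker ((MvPolynomial.aeval fun p : MatIdx m × MatIdx m => ∑ l : MatIdx m, (P (ofLex p.2).1 (ofLex l).1 * Q (ofLex l).2 (ofLex p.2).2) • (MvPolynomial.X (p.1, l) : MvPolynomial (MatIdx m × MatIdx m) ℂ)).toLinearMap - (LinearMap.id : MvPolynomial (MatIdx m × MatIdx m) ℂ →ₗ[ℂ] MvPolynomial (MatIdx m × MatIdx m) ℂ))) ⊓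
          (⨅ (g : Matrix.GeneralLinearGroup (MatIdx m) ℂ) (_ : IsUpperTriangular g), LinearMap.ker ((MvPolynomial.aeval fun p : MatIdx m × MatIdx m => ∑ l : MatIdx m, ((g⁻¹ : Matrix.GeneralLinearGroup (MatIdx m) ℂ) : Matrix (MatIdx m) (MatIdx m) ℂ) p.1 l • (MvPolynomial.X (l, p.2) : MvPolynomial (MatIdx m × MatIdx m) ℂ)).toLinearMap - weightChar ((Weight.dualOfPartition (m * m) lam).toMatIdx : Weight (MatIdx m)) g • (LinearMap.id : MvPolynomial (MatIdx m × MatIdx m) ℂ →ₗ[ℂ] MvPolynomial (MatIdx m × MatIdx m) ℂ)))) <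
        orbitMultiplicity ℂ (paddedPerFormLex ℂ n m) m ((Weight.dualOfPartition (m * m) lam).toMatIdx : Weight (MatIdx m)))
    (n m : ℕ) [NeZero m] (hnm : n ≤ m) (hm2 : 2 ≤ m) (g : GL (MatIdx m) ℂ)
    (hg : 2 * m ^ 2 + m + 2 ≤ Module.finrank ℂ ↥(Submodule.span ℂ (Set.range fun ab : {a : MatIdx m // m * m ≤ (((matIdxEquiv m).symm a : Fin (m * m)) : ℕ) + 4} × MatIdx m => (MvPolynomial.X ab.1.1 : MvPolynomial (MatIdx m) ℂ) * MvPolynomial.aeval (fun i : MatIdx m => if m * m ≤ (((matIdxEquiv m).symm i : Fin (m * m)) : ℕ) + 4 then (MvPolynomial.X i : MvPolynomial (MatIdx m) ℂ) else 0) (MvPolynomial.pderiv ab.2 (linSubst (MatIdx m) ℂ ((g : GL (MatIdx m) ℂ) : Matrix (MatIdx m) (MatIdx m) ℂ) (paddedPerFormLex ℂ n m)))))) :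
    ∃ (δ : ℕ) (lam : Nat.Partition (m * δ)), lam.parts.card ≤ 4 ∧
        Module.finrank ℂ ↥(MvPolynomial.homogeneousSubmodule (MatIdx m × MatIdx m) ℂ (m * δ) ⊓
          (⨅ (P : Matrix (Fin m) (Fin m) ℂ) (Q : Matrix (Fin m) (Fin m) ℂ) (_ : P.det = 1) (_ : Q.det = 1), LinearMap.ker ((MvPolynomial.aeval fun p : MatIdx m × MatIdx m => ∑ l : MatIdx m, (P (ofLex p.2).1 (ofLex l).1 * Q (ofLex l).2 (ofLex p.2).2) • (MvPolynomial.X (p.1, l) : MvPolynomial (MatIdx m × MatIdx m) ℂ)).toLinearMap - (LinearMap.id : MvPolynomial (MatIdx m × MatIdx m) ℂ →ₗ[ℂ] MvPolynomial (MatIdx m × MatIdx m) ℂ))) ⊓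
          (⨅ (g : Matrix.GeneralLinearGroup (MatIdx m) ℂ) (_ : IsUpperTriangular g), LinearMap.ker ((MvPolynomial.aeval fun p : MatIdx m × MatIdx m => ∑ l : MatIdx m, ((g⁻¹ : Matrix.GeneralLinearGroup (MatIdx m) ℂ) : Matrix (MatIdx m) (MatIdx m) ℂ) p.1 l • (MvPolynomial.X (l, p.2) : MvPolynomial (MatIdx m × MatIdx m) ℂ)).toLinearMap - weightChar ((Weight.dualOfPartition (m * m) lam).toMatIdx : Weight (MatIdx m)) g • (LinearMap.id : MvPolynomial (MatIdx m × MatIdx m) ℂ →ₗ[ℂ] MvPolynomial (MatIdx m × MatIdx m) ℂ)))) <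
        orbitMultiplicity ℂ (paddedPerFormLex ℂ n m) m ((Weight.dualOfPartition (m * m) lam).toMatIdx : Weight (MatIdx m)) := by
  have hzN : (2 * m ^ 2 + m) + 1 ≤ 2 * m ^ 2 + m + 1 := le_rfl
  obtain ⟨δ, hδ⟩ := stub_growthGap m (2 * m ^ 2 + m) (2 * m ^ 2 + m + 1) hzN
  have hN : (2 * m ^ 2 + m + 1) + 1 ≤ Module.finrank ℂ ↥(Submodule.span ℂ (Set.range fun ab : {a : MatIdx m // m * m ≤ (((matIdxEquiv m).symm a : Fin (m * m)) : ℕ) + 4} × MatIdx m => (MvPolynomial.X ab.1.1 : MvPolynomial (MatIdx m) ℂ) * MvPolynomial.aeval (fun i : MatIdx m => if m * m ≤ (((matIdxEquiv m).symm i : Fin (m * m)) : ℕ) + 4 then (MvPolynomial.X i : MvPolynomial (MatIdx m) ℂ) else 0) (MvPolynomial.pderiv ab.2 (linSubst (MatIdx m) ℂ ((g : GL (MatIdx m) ℂ) : Matrix (MatIdx m) (MatIdx m) ℂ) (paddedPerFormLex ℂ n m))))) := by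
    have h22 : (2 * m ^ 2 + m + 1) + 1 = 2 * m ^ 2 + m + 2 := by ring
    rw [h22]
    exact hg
  have h3 := hS3 n m hnm g (2 * m ^ 2 + m + 1) δ hN
  have h1 := hS1 m hm2 (m * δ)
  have hgap := lt_of_le_of_lt h1 (lt_of_lt_of_le hδ h3)
  obtain ⟨lam, hcard, hlt⟩ := hS4 n m δ hnm hm2 hgap
  exact ⟨δ, lam, hcard, hlt⟩

/-- **The linear head of the window, slope-general** (the body of `HeadFlip` for the slope `a/b`):
for all large `n` and every `n ≤ m`, `b·m ≤ a·n`, the flip body holds with the no-cut centre `U = ⊥`,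
`r = 0` (`T_⊥ ≤ Hom ⊓ SAND` by the landed `stub_stabInv_le_explicit`).  The parent's
`headFlipBody_of` with `5·m ≤ 6·n` replaced by `b·m ≤ a·n`. [parent line four-row-count] -/
theorem headFlipBody_of' (a b : ℕ) (hS1 : ∀ (m : ℕ), 2 ≤ m → ∀ D : ℕ,
      Module.finrank ℂ ↥(MvPolynomial.homogeneousSubmodule (MatIdx m × MatIdx m) ℂ (D) ⊓
        (⨅ (P : Matrix (Fin m) (Fin m) ℂ) (Q : Matrix (Fin m) (Fin m) ℂ) (_ : P.det = 1) (_ : Q.det = 1), LinearMap.ker ((MvPolynomial.aeval fun p : MatIdx m × MatIdx m => ∑ l : MatIdx m, (P (ofLex p.2).1 (ofLex l).1 * Q (ofLex l).2 (ofLex p.2).2) • (MvPolynomial.X (p.1, l) : MvPolynomial (MatIdx m × MatIdx m) ℂ)).toLinearMap - (LinearMap.id : MvPolynomial (MatIdx m × MatIdx m) ℂ →ₗ[ℂ] MvPolynomial (MatIdx m × MatIdx m) ℂ))) ⊓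
        Subalgebra.toSubmodule (MvPolynomial.supported ℂ {p : MatIdx m × MatIdx m | m * m ≤ (((matIdxEquiv m).symm p.1 : Fin (m * m)) : ℕ) + 4})) ≤ (D + 1) ^ (2 * m ^ 2 + m))
    (hS2 : ∃ n₀ : ℕ, ∀ n ≥ n₀, ∀ (m : ℕ) [NeZero m], n ≤ m → b * m ≤ a * n →
      ∃ g : GL (MatIdx m) ℂ, 2 * m ^ 2 + m + 2 ≤ Module.finrank ℂ ↥(Submodule.span ℂ (Set.range fun ab : {a : MatIdx m // m * m ≤ (((matIdxEquiv m).symm a : Fin (m * m)) : ℕ) + 4} × MatIdx m => (MvPolynomial.X ab.1.1 : MvPolynomial (MatIdx m) ℂ) * MvPolynomial.aeval (fun i : MatIdx m => if m * m ≤ (((matIdxEquiv m).symm i : Fin (m * m)) : ℕ) + 4 then (MvPolynomial.X i : MvPolynomial (MatIdx m) ℂ) else 0) (MvPolynomial.pderiv ab.2 (linSubst (MatIdx m) ℂ ((g : GL (MatIdx m) ℂ) : Matrix (MatIdx m) (MatIdx m) ℂ) (paddedPerFormLex ℂ n m))))))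
    (hS3 : ∀ (n m : ℕ) [NeZero m], n ≤ m → ∀ (g : GL (MatIdx m) ℂ) (N δ : ℕ),
      N + 1 ≤ Module.finrank ℂ ↥(Submodule.span ℂ (Set.range fun ab : {a : MatIdx m // m * m ≤ (((matIdxEquiv m).symm a : Fin (m * m)) : ℕ) + 4} × MatIdx m => (MvPolynomial.X ab.1.1 : MvPolynomial (MatIdx m) ℂ) * MvPolynomial.aeval (fun i : MatIdx m => if m * m ≤ (((matIdxEquiv m).symm i : Fin (m * m)) : ℕ) + 4 then (MvPolynomial.X i : MvPolynomial (MatIdx m) ℂ) else 0) (MvPolynomial.pderiv ab.2 (linSubst (MatIdx m) ℂ ((g : GL (MatIdx m) ℂ) : Matrix (MatIdx m) (MatIdx m) ℂ) (paddedPerFormLex ℂ n m))))) →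
      Nat.choose (δ + N) N ≤ Module.finrank ℂ ↥(((MvPolynomial.homogeneousSubmodule (DegIdx (MatIdx m) m) ℂ δ ⊓ Subalgebra.toSubmodule (MvPolynomial.supported ℂ {d : DegIdx (MatIdx m) m | ∀ i : MatIdx m, ¬ (m * m ≤ (((matIdxEquiv m).symm i : Fin (m * m)) : ℕ) + 4) → d.1 i = 0})).map (genericOrbitMap (paddedPerFormLex ℂ n m) m).toLinearMap)))
    (hS4 : ∀ (n m : ℕ) [NeZero m] (δ : ℕ), n ≤ m → 2 ≤ m →
      Module.finrank ℂ ↥(MvPolynomial.homogeneousSubmodule (MatIdx m × MatIdx m) ℂ (m * δ) ⊓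
        (⨅ (P : Matrix (Fin m) (Fin m) ℂ) (Q : Matrix (Fin m) (Fin m) ℂ) (_ : P.det = 1) (_ : Q.det = 1), LinearMap.ker ((MvPolynomial.aeval fun p : MatIdx m × MatIdx m => ∑ l : MatIdx m, (P (ofLex p.2).1 (ofLex l).1 * Q (ofLex l).2 (ofLex p.2).2) • (MvPolynomial.X (p.1, l) : MvPolynomial (MatIdx m × MatIdx m) ℂ)).toLinearMap - (LinearMap.id : MvPolynomial (MatIdx m × MatIdx m) ℂ →ₗ[ℂ] MvPolynomial (MatIdx m × MatIdx m) ℂ))) ⊓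
        Subalgebra.toSubmodule (MvPolynomial.supported ℂ {p : MatIdx m × MatIdx m | m * m ≤ (((matIdxEquiv m).symm p.1 : Fin (m * m)) : ℕ) + 4})) <
      Module.finrank ℂ ↥(((MvPolynomial.homogeneousSubmodule (DegIdx (MatIdx m) m) ℂ δ ⊓ Subalgebra.toSubmodule (MvPolynomial.supported ℂ {d : DegIdx (MatIdx m) m | ∀ i : MatIdx m, ¬ (m * m ≤ (((matIdxEquiv m).symm i : Fin (m * m)) : ℕ) + 4) → d.1 i = 0})).map (genericOrbitMap (paddedPerFormLex ℂ n m) m).toLinearMap)) →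
      ∃ lam : Nat.Partition (m * δ), lam.parts.card ≤ 4 ∧
        Module.finrank ℂ ↥(MvPolynomial.homogeneousSubmodule (MatIdx m × MatIdx m) ℂ (m * δ) ⊓
          (⨅ (P : Matrix (Fin m) (Fin m) ℂ) (Q : Matrix (Fin m) (Fin m) ℂ) (_ : P.det = 1) (_ : Q.det = 1), LinearMap.ker ((MvPolynomial.aeval fun p : MatIdx m × MatIdx m => ∑ l : MatIdx m, (P (ofLex p.2).1 (ofLex l).1 * Q (ofLex l).2 (ofLex p.2).2) • (MvPolynomial.X (p.1, l) : MvPolynomial (MatIdx m × MatIdx m) ℂ)).toLinearMap - (LinearMap.id : MvPolynomial (MatIdx m × MatIdx m) ℂ →ₗ[ℂ] MvPolynomial (MatIdx m × MatIdx m) ℂ))) ⊓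
          (⨅ (g : Matrix.GeneralLinearGroup (MatIdx m) ℂ) (_ : IsUpperTriangular g), LinearMap.ker ((MvPolynomial.aeval fun p : MatIdx m × MatIdx m => ∑ l : MatIdx m, ((g⁻¹ : Matrix.GeneralLinearGroup (MatIdx m) ℂ) : Matrix (MatIdx m) (MatIdx m) ℂ) p.1 l • (MvPolynomial.X (l, p.2) : MvPolynomial (MatIdx m × MatIdx m) ℂ)).toLinearMap - weightChar ((Weight.dualOfPartition (m * m) lam).toMatIdx : Weight (MatIdx m)) g • (LinearMap.id : MvPolynomial (MatIdx m × MatIdx m) ℂ →ₗ[ℂ] MvPolynomial (MatIdx m × MatIdx m) ℂ)))) <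
        orbitMultiplicity ℂ (paddedPerFormLex ℂ n m) m ((Weight.dualOfPartition (m * m) lam).toMatIdx : Weight (MatIdx m))) :
    ∃ n₀ : ℕ, ∀ n ≥ n₀, ∀ (m : ℕ) [NeZero m], n ≤ m → b * m ≤ a * n →
      ∃ (U : Submodule ℂ (MatIdx m → ℂ)) (r δ : ℕ) (lam : Nat.Partition (m * δ)), (∀ u ∈ U, (Matrix.of fun a b : Fin m => u (toLex (a, b))).rank ≤ r) ∧ lam.parts.card ≤ m * m ∧ (let χ : Weight (MatIdx m) := (Weight.dualOfPartition (m * m) lam).toMatIdx; let T : Submodule ℂ (MvPolynomial (MatIdx m × MatIdx m) ℂ) := MvPolynomial.homogeneousSubmodule (MatIdx m × MatIdx m) ℂ (m * δ) ⊓ ((MvPolynomial.vanishingIdeal ℂ {p : MatIdx m × MatIdx m → ℂ | ∀ j : MatIdx m, (fun i => p (j, i)) ∈ U}) ^ (δ * (m - r))).restrictScalars ℂ ⊓ (⨅ (M : Matrix (MatIdx m) (MatIdx m) ℂ) (_ : linSubst (MatIdx m) ℂ M (detFormLex ℂ m) = detFormLex ℂ m), LinearMap.ker ((MvPolynomial.aeval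 (R := ℂ) fun p : MatIdx m × MatIdx m => ∑ l : MatIdx m, M l p.2 • MvPolynomial.X (p.1, l)).toLinearMap - LinearMap.id (R := ℂ) (M := MvPolynomial (MatIdx m × MatIdx m) ℂ))) ⊓ (⨅ (g : Matrix.GeneralLinearGroup (MatIdx m) ℂ) (_ : IsUpperTriangular g), LinearMap.ker ((MvPolynomial.aeval (R := ℂ) fun p : MatIdx m × MatIdx m => ∑ l : MatIdx m, ((g⁻¹ : Matrix.GeneralLinearGroup (MatIdx m) ℂ) : Matrix (MatIdx m) (MatIdx m) ℂ) p.1 l • MvPolynomial.X (l, p.2)).toLinearMap - weightChar χ g • LinearMap.id (R := ℂ) (M := MvPolynomial (MatIdx m × MatIdx m) ℂ))); Module.finrank ℂ ↥T < orbitMultiplicity ℂ (paddedPerFormLex ℂ n m) m χ) := by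
  obtain ⟨n₁, hn₁⟩ := hS2
  refine ⟨max n₁ 3, fun n hn m _ hnm hbm => ?_⟩
  have hn1 : n₁ ≤ n := le_of_max_le_left hn
  have hn3 : 3 ≤ n := le_of_max_le_right hn
  have hm2 : 2 ≤ m := by omega
  obtain ⟨g, hg⟩ := hn₁ n hn1 m hnm hbm
  obtain ⟨δ, lam, hcard, hlt⟩ := headCensus_of hS1 hS3 hS4 n m hnm hm2 g hg
  refine ⟨⊥, 0, δ, lam, ?_, ?_, ?_⟩
  · intro u hu
    rw [Submodule.mem_bot] at hu
    subst hu
    have h0 : (Matrix.of fun a b : Fin m => (0 : MatIdx m → ℂ) (toLex (a, b))) = 0 := by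
      ext a b
      simp
    rw [h0, Matrix.rank_zero]
  · exact hcard.trans (by nlinarith)
  · intro χ T
    haveI : Module.Finite ℂ ↥(MvPolynomial.homogeneousSubmodule (MatIdx m × MatIdx m) ℂ (m * δ)) :=
      Module.Finite.iff_fg.mpr (MvPolynomial.homogeneousSubmodule_fg (MatIdx m × MatIdx m) ℂ (m * δ))
    haveI : Module.Finite ℂ ↥(MvPolynomial.homogeneousSubmodule (MatIdx m × MatIdx m) ℂ (m * δ) ⊓
          (⨅ (P : Matrix (Fin m) (Fin m) ℂ) (Q : Matrix (Fin m) (Fin m) ℂ) (_ : P.det = 1) (_ : Q.det = 1), LinearMap.ker ((MvPolynomial.aeval fun p : MatIdx m × MatIdx m => ∑ l : MatIdx m, (P (ofLex p.2).1 (ofLex l).1 * Q (ofLex l).2 (ofLex p.2).2) • (MvPolynomial.X (p.1, l) : MvPolynomial (MatIdx m × MatIdx m) ℂ)).toLinearMap - (LinearMap.id : MvPolynomial (MatIdx m × MatIdx m) ℂ →ₗ[ℂ] MvPolynomial (MatIdx m × MatIdx m) ℂ))) ⊓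
          (⨅ (g : Matrix.GeneralLinearGroup (MatIdx m) ℂ) (_ : IsUpperTriangular g), LinearMap.ker ((MvPolynomial.aeval fun p : MatIdx m × MatIdx m => ∑ l : MatIdx m, ((g⁻¹ : Matrix.GeneralLinearGroup (MatIdx m) ℂ) : Matrix (MatIdx m) (MatIdx m) ℂ) p.1 l • (MvPolynomial.X (l, p.2) : MvPolynomial (MatIdx m × MatIdx m) ℂ)).toLinearMap - weightChar ((Weight.dualOfPartition (m * m) lam).toMatIdx : Weight (MatIdx m)) g • (LinearMap.id : MvPolynomial (MatIdx m × MatIdx m) ℂ →ₗ[ℂ] MvPolynomial (MatIdx m × MatIdx m) ℂ)))) :=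
      Submodule.finiteDimensional_of_le (inf_le_left.trans inf_le_left)
    exact lt_of_le_of_lt (Submodule.finrank_mono (inf_le_inf (le_inf (inf_le_left.trans inf_le_left)
      (inf_le_right.trans ((stub_stabInv_le_explicit m).trans inf_le_left))) le_rfl)) hlt

/-- **The crux from the line**: `ValuativeGCT.HeadFlip` BY NAME from the four registered stubs (used
by name; `sorryAx` enters only through them): the slope `(a, b)` is the one produced by
`stub_rankBound`; the slice bound is the LANDED `stub_fourRowSliceBound`. [this line] -/
theorem HeadFlip_of :
    Summit.ValiantsHypothesis.ValiantsHypothesis.Theses.ValuativeGCT.HeadFlip := by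
  have hS1 := stub_fourRowSliceBound
  have hS3 := stub_fourRowHilbertLowerBound
  have hS4 := stub_fourRowBridge
  obtain ⟨a, b, hb, hba, hcert⟩ := pencilCertificate_of stub_subpermDiagRankOne stub_rankBound
  have hS2 := fourRowPencilRank_of_pencilCertificate' a b hb hcert
  obtain ⟨n₀, hHead⟩ := headFlipBody_of' a b hS1 hS2 hS3 hS4
  exact ⟨a, b, hba, n₀, hHead⟩

end

end Summit.ValiantsHypothesis.ValiantsHypothesis.Cruxes.HeadFlip.FourRowCount
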